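import Summits.AtomisticToContinuum.HydrodynamicLimit.Theorems.RelayRaceLocalityLightConeInLawDoDWeight

/-!
# The cone lemma: finite domain of dependence for one smooth hyperbolic equation of state
(crux `LightConeInLaw`, stmt-AtomisticToContinuum-12500, `--supports`; route `RelayRaceLocality`,
sub-problem `HydrodynamicLimit`; lead c1)

Second of three files of the domain-of-dependence leg (sequel of `…DoDWeight.lean`):

* `cone_unique_of_smooth_eos` (registered) — in the setting of the tree's
  `IsHardSphereEulerSolution.unique_of_smooth_eos` (two classical solutions on `[0, T) × 𝕋³` with
  pressure `ρθζ(ρ)`, `ζ` smooth with `ζ + id·ζ' > 0` on the density range), plus a flux-domination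
  constant `s` (`|ν·Φ| ≤ ‖ν‖ s e`) and `π s T ≤ a₀`: equal data on the pseudo-ball `{Q_y < a₀²}`
  force equal solutions on the shrinking pseudo-balls `{Q_y < (a₀ - π s t)²}` — the weighted shell
  with the cone weight, the balance `∂ₜe + Σᵢ∂ᵢΦᵢ = R ≤ C e` being that of the unweighted theorem
  (`relativeEnergy_balance`, `relativeEnergy_remainder_le`, `relativeEnergy_coercive`).

Reference: Dafermos 2005, §5.2, Thm 5.2.1, (5.2.1). [Dafermos2005]
-/

namespace Summit.AtomisticToContinuum.HydrodynamicLimit.Theorems.LightConeInLawSketch.DoD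

open scoped BigOperators Topology Classical ENNReal
open Filter Set MeasureTheory
open Literature.MathematicalPhysics.KineticTheory Literature.Analysis.FluidPDE
  Literature.Analysis.FunctionSpaces

noncomputable section

open HsEulerCalc

/-! ### The cone lemma for one smooth, hyperbolic equation of state -/

/-- **Finite domain of dependence for classical hard-sphere Euler solutions with a smooth,
hyperbolic equation of state (cone lemma).** Setting of
`IsHardSphereEulerSolution.unique_of_smooth_eos` (two classical solutions on `[0, T) × 𝕋³` with
pressure `ρ θ ζ(ρ)`, `ζ` smooth on an open `J ⊇ [a, b]` with `ζ + id·ζ' > 0` on `[a, b]`,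
densities valued in `[a, b]`), plus: a FLUX DOMINATION constant `s ≥ 0` for the relative-energy
fluxes `Φ` against the energy `e` (`|ν · Φ| ≤ ‖ν‖ s e` pointwise on `[0, T) × 𝕋³`, every `ν`) and
a radius parameter `a₀` with `π s T ≤ a₀`. If the two solutions have the same data on the
pseudo-ball `{x | Q_y(x) < a₀²}` (`Q_y(x) = Σᵢ sin²(π‖(x - y)ᵢ‖)`), then they coincide at every
`(t, x)` with `t ∈ [0, T)` and `Q_y(x) < (a₀ - π s t)²` — in particular at the centre `y` for all
`t ∈ [0, T)`. Proof: the weighted shell `torus_weighted_energy_eq_zero` with the cone weight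
`w = expNegInvGlue((a₀ - π s t)² - Q_y)` (`coneWeight_transport` supplies the transport
inequality, the balance `∂ₜe + Σᵢ∂ᵢΦᵢ = R ≤ C e` is that of the unweighted uniqueness theorem),
and `w > 0` exactly on the shrinking pseudo-balls. (Dafermos 2005, Thm 5.2.1, (5.2.1) with the
cone `|x| < R + s t ↦ |x| < R`, classical-vs-classical case, on `𝕋³`, in smooth-cutoff form.) -/
theorem cone_unique_of_smooth_eos :
    ∀ {σ T : ℝ} {ρ θ ρ' θ' : ℝ → T3 → ℝ} {u u' : ℝ → T3 → V3} {ζ : ℝ → ℝ} {J : Set ℝ} {a b : ℝ},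
    IsHardSphereEulerSolution σ T ρ u θ → IsHardSphereEulerSolution σ T ρ' u' θ' →
    IsOpen J → ContDiffOn ℝ (⊤ : ℕ∞) ζ J → Icc a b ⊆ J →
    (∀ r ∈ Icc a b, 0 < ζ r + r * deriv ζ r) →
    (∀ t ∈ Ico 0 T, ∀ x, ρ t x ∈ Icc a b) → (∀ t ∈ Ico 0 T, ∀ x, ρ' t x ∈ Icc a b) →
    (∀ t ∈ Ico 0 T, ∀ x, hsPressure σ (ρ t x) (θ t x) = ρ t x * θ t x * ζ (ρ t x)) →
    (∀ t ∈ Ico 0 T, ∀ x, hsPressure σ (ρ' t x) (θ' t x) = ρ' t x * θ' t x * ζ (ρ' t x)) →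
    ∀ {s a₀ : ℝ}, 0 ≤ s → Real.pi * s * T ≤ a₀ →
    (∀ t ∈ Ico 0 T, ∀ x, ∀ ν : Fin 3 → ℝ,
      |∑ i, ν i * (1 / 2 * (θ t x * (ζ (ρ t x) + ρ t x * deriv ζ (ρ t x)) / ρ t x * u t x i *
              (ρ t x - ρ' t x) ^ 2 +
            ρ t x * u t x i * ‖u t x - u' t x‖ ^ 2 +
            3 / 2 * ρ t x / θ t x * u t x i * (θ t x - θ' t x) ^ 2) +
          θ t x * (ζ (ρ t x) + ρ t x * deriv ζ (ρ t x)) * (ρ t x - ρ' t x) * (u t x i - u' t x i) +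
          ρ t x * ζ (ρ t x) * (θ t x - θ' t x) * (u t x i - u' t x i))| ≤
        Real.sqrt (∑ i, ν i ^ 2) * s * (1 / 2 *
          (θ t x * (ζ (ρ t x) + ρ t x * deriv ζ (ρ t x)) / ρ t x * (ρ t x - ρ' t x) ^ 2 +
            ρ t x * ‖u t x - u' t x‖ ^ 2 + 3 / 2 * ρ t x / θ t x * (θ t x - θ' t x) ^ 2))) →
    ∀ {y : T3},
    (∀ x, ∑ i : Fin 3, Real.sin (Real.pi * ‖(x - y) i‖) ^ 2 < a₀ ^ 2 →
      ρ 0 x = ρ' 0 x ∧ u 0 x = u' 0 x ∧ θ 0 x = θ' 0 x) →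
    ∀ t ∈ Ico 0 T, ∀ x, ∑ i : Fin 3, Real.sin (Real.pi * ‖(x - y) i‖) ^ 2 < (a₀ - Real.pi * s * t) ^ 2 →
      ρ t x = ρ' t x ∧ u t x = u' t x ∧ θ t x = θ' t x := by
  intro σ T ρ θ ρ' θ' u u' ζ J a b hE hE' hJ hζ hab hγ hρab hρab' hp hp' s a₀ hs hsT hdom y h0
  have hU : UniqueDiffOn ℝ (Ico (0 : ℝ) T) := uniqueDiffOn_Ico 0 T
  have hρJ : ∀ t ∈ Ico 0 T, ∀ x, ρ t x ∈ J := fun t ht x => hab (hρab t ht x)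
  have hρJ' : ∀ t ∈ Ico 0 T, ∀ x, ρ' t x ∈ J := fun t ht x => hab (hρab' t ht x)
  have hρ := hE.smooth_density
  have hθ := hE.smooth_temperature
  have hu := hE.smooth_velocity
  have hρ' := hE'.smooth_density
  have hθ' := hE'.smooth_temperature
  have hu' := hE'.smooth_velocity
  have hζρ := isSmoothSpaceTimeOn_comp_density hρ hζ hρJ
  have hζdρ := isSmoothSpaceTimeOn_comp_density hρ (hζ.deriv_of_isOpen (m := (⊤ : ℕ∞)) hJ le_rfl) hρJ
  have hAf := hE.isSmoothSpaceTimeOn_weightA hJ hζ hρJ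
  have hBf := hE.isSmoothSpaceTimeOn_weightB
  have hγf : Torus.IsSmoothSpaceTimeOn (Ico 0 T)
      (fun s y => ζ (ρ s y) + ρ s y * deriv ζ (ρ s y)) := hζρ.add (hρ.mul hζdρ)
  -- the energy density and the fluxes are jointly smooth
  have hal2 : Torus.IsSmoothSpaceTimeOn (Ico 0 T) (fun t x => (ρ t x - ρ' t x) ^ 2) :=
    (hρ.sub hρ').pow 2
  have hbe2 : Torus.IsSmoothSpaceTimeOn (Ico 0 T) (fun t x => (θ t x - θ' t x) ^ 2) :=
    (hθ.sub hθ').pow 2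
  have hw2 : Torus.IsSmoothSpaceTimeOn (Ico 0 T) (fun t x => ‖u t x - u' t x‖ ^ 2) :=
    (hu.sub hu').norm_sq ℝ
  have hhalf : Torus.IsSmoothSpaceTimeOn (Ico 0 T) (fun (_ : ℝ) (_ : T3) => (1 / 2 : ℝ)) :=
    Torus.isSmoothSpaceTimeOn_const (Torus.isSmooth_const _) _
  have he : Torus.IsSmoothSpaceTimeOn (Ico 0 T) (fun s y => 1 / 2 *
      (θ s y * (ζ (ρ s y) + ρ s y * deriv ζ (ρ s y)) / ρ s y * (ρ s y - ρ' s y) ^ 2 +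
        ρ s y * ‖u s y - u' s y‖ ^ 2 + 3 / 2 * ρ s y / θ s y * (θ s y - θ' s y) ^ 2)) :=
    hhalf.mul (((hAf.mul hal2).add (hρ.mul hw2)).add (hBf.mul hbe2))
  have hΦ : ∀ i, Torus.IsSmoothSpaceTimeOn (Ico 0 T) (fun t y =>
      1 / 2 * (θ t y * (ζ (ρ t y) + ρ t y * deriv ζ (ρ t y)) / ρ t y * u t y i *
            (ρ t y - ρ' t y) ^ 2 +
          ρ t y * u t y i * ‖u t y - u' t y‖ ^ 2 +
          3 / 2 * ρ t y / θ t y * u t y i * (θ t y - θ' t y) ^ 2) +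
        θ t y * (ζ (ρ t y) + ρ t y * deriv ζ (ρ t y)) * (ρ t y - ρ' t y) * (u t y i - u' t y i) +
        ρ t y * ζ (ρ t y) * (θ t y - θ' t y) * (u t y i - u' t y i)) := fun i =>
    ((hhalf.mul ((((hAf.mul (hu.apply i)).mul hal2).add ((hρ.mul (hu.apply i)).mul hw2)).add
      ((hBf.mul (hu.apply i)).mul hbe2))).add
      (((hθ.mul hγf).mul (hρ.sub hρ')).mul ((hu.apply i).sub (hu'.apply i)))).add
      (((hρ.mul hζρ).mul (hθ.sub hθ')).mul ((hu.apply i).sub (hu'.apply i)))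
  have hApos : ∀ t ∈ Ico 0 T, ∀ x, 0 < θ t x * (ζ (ρ t x) + ρ t x * deriv ζ (ρ t x)) / ρ t x :=
    fun t ht x => div_pos (mul_pos (hE.temperature_pos t ht x) (hγ _ (hρab t ht x)))
      (hE.density_pos t ht x)
  have hBpos : ∀ t ∈ Ico 0 T, ∀ x, 0 < 3 / 2 * ρ t x / θ t x := fun t ht x =>
    div_pos (mul_pos (by norm_num) (hE.density_pos t ht x)) (hE.temperature_pos t ht x)
  have henonneg : ∀ t ∈ Ico 0 T, ∀ x, 0 ≤ 1 / 2 *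
      (θ t x * (ζ (ρ t x) + ρ t x * deriv ζ (ρ t x)) / ρ t x * (ρ t x - ρ' t x) ^ 2 +
        ρ t x * ‖u t x - u' t x‖ ^ 2 + 3 / 2 * ρ t x / θ t x * (θ t x - θ' t x) ^ 2) :=
    fun t ht x => mul_nonneg (by norm_num) (add_nonneg (add_nonneg
      (mul_nonneg (hApos t ht x).le (sq_nonneg _))
      (mul_nonneg (hE.density_pos t ht x).le (sq_nonneg _)))
      (mul_nonneg (hBpos t ht x).le (sq_nonneg _)))
  -- the cone weight
  have hw := coneWeight_smooth y a₀ (Real.pi * s) (Ico 0 T)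
  have hzero := torus_weighted_energy_eq_zero (Φ := fun i t y =>
      1 / 2 * (θ t y * (ζ (ρ t y) + ρ t y * deriv ζ (ρ t y)) / ρ t y * u t y i *
            (ρ t y - ρ' t y) ^ 2 +
          ρ t y * u t y i * ‖u t y - u' t y‖ ^ 2 +
          3 / 2 * ρ t y / θ t y * u t y i * (θ t y - θ' t y) ^ 2) +
        θ t y * (ζ (ρ t y) + ρ t y * deriv ζ (ρ t y)) * (ρ t y - ρ' t y) * (u t y i - u' t y i) +
        ρ t y * ζ (ρ t y) * (θ t y - θ' t y) * (u t y i - u' t y i)) he hΦ hw henonneg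
    (fun t _ x => coneWeight_nonneg y a₀ (Real.pi * s) t x) (fun x => ?_) (fun t₁ ht₁ => ?_)
    (fun t ht x => ?_)
  · -- conclusion: inside the shrinking pseudo-ball the weight is positive, so `e = 0`
    intro t ht x hx
    have hwpos : 0 < expNegInvGlue ((a₀ - Real.pi * s * t) ^ 2 -
        ∑ i : Fin 3, Real.sin (Real.pi * ‖(x - y) i‖) ^ 2) :=
      expNegInvGlue.pos_of_pos (by linarith)
    have he0 := (mul_eq_zero.1 (hzero t ht x)).resolve_left hwpos.ne'
    have hpt := eq_of_energy_eq_zero (hApos t ht x) (hE.density_pos t ht x) (hBpos t ht x) he0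
    exact ⟨sub_eq_zero.1 hpt.1, sub_eq_zero.1 hpt.2.1, sub_eq_zero.1 hpt.2.2⟩
  · -- `w(0, ·) e(0, ·) = 0`
    by_cases hx : ∑ i : Fin 3, Real.sin (Real.pi * ‖(x - y) i‖) ^ 2 < a₀ ^ 2
    · obtain ⟨h1, h2, h3⟩ := h0 x hx
      rw [h1, h2, h3]
      simp
    · have hw0 : expNegInvGlue ((a₀ - Real.pi * s * 0) ^ 2 -
          ∑ i : Fin 3, Real.sin (Real.pi * ‖(x - y) i‖) ^ 2) = 0 :=
        expNegInvGlue.zero_of_nonpos (by rw [mul_zero, sub_zero]; linarith [not_lt.1 hx])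
      rw [hw0, zero_mul]
  · -- the balance `∂ₜe + Σᵢ∂ᵢΦᵢ = R ≤ C e` on `[0, t₁] × 𝕋³`
    obtain ⟨C, hC⟩ := hE.relativeEnergy_remainder_le hE' hJ hζ hab hρab hρab' ht₁
    obtain ⟨m, hm0, hm⟩ := hE.relativeEnergy_coercive hJ hζ hab hγ hρab ρ' θ' u' ht₁
    refine ⟨max C 0 / m, fun t ht x => ?_⟩
    have htT : t ∈ Ico 0 T := ⟨ht.1, ht.2.trans_lt ht₁.2⟩
    exact (hE.relativeEnergy_balance hE' hJ hζ hρJ hρJ' hp hp' htT x).trans_le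
      (le_max_div_mul_of_le (hC t ht x) (hm t ht x) (by positivity) hm0)
  · -- the transport inequality of the cone weight
    have htle : Real.pi * s * t ≤ a₀ := by
      have : Real.pi * s * t ≤ Real.pi * s * T :=
        mul_le_mul_of_nonneg_left ht.2.le (by positivity)
      linarith
    rw [coneWeight_timeDerivWithin y a₀ (Real.pi * s) (hU t ht) x]
    simp_rw [coneWeight_partialDeriv y a₀ (Real.pi * s) t x]
    exact coneWeight_transport hs htle (henonneg t ht x) (hdom t ht x)

end

end Summit.AtomisticToContinuum.HydrodynamicLimit.Theorems.LightConeInLawSketch.DoD
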